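import Literature.AlgebraicGeometry.HodgeTheory.WeilClassesDescendingHolds
import Literature.AlgebraicGeometry.HodgeTheory.WeilClassesSurfacesAlgebraic
import Literature.AlgebraicGeometry.HodgeTheory.HyperbolicWeilTypeBalanced
import Literature.AlgebraicGeometry.HodgeTheory.WeilClassesRationalPlane
import Literature.AlgebraicGeometry.HodgeTheory.WeilClassesHodgeType
import Literature.AlgebraicGeometry.HodgeTheory.WeilClassesFourfoldsProofs
import HarnessLib

/-!
# Hyperbolic (split) abelian varieties of Weil type EXIST in every dimension `2n ≥ 4`, for every `K = ℚ(√-d)`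

Family `hodge`, layer `Literature/AlgebraicGeometry/HodgeTheory`. PROOFS ONLY (no definition, no named fact).
Requested by the B2b ladder `hodge-weil` (packet `run/shared/lean/b2b/hodge-weil/`, prover 2 gen 3): the on-path
lemma of the local-anchor predicate `HasLocallyAlgebraicWeilAnchor n d` (`WeilClassesLocalAnchor.lean`) reduces,
under the Hodge conjecture, to the EXISTENCE of a hyperbolic `(P, ψ₀, e, a)` of dimension `2n` with `ψ₀ ≫ ψ₀ = -d`
carrying a non-zero rational Weil class; the same existence statement inhabits the hypotheses of every SPLIT rung
and floor fact of the ladder (`Markman2025_weilClasses_algebraic_hyperbolicSixfold`, `SplitEightfolds`,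
`SplitWeilAbelianVarieties`) — anti-vacuity. It is assembled here from theorems of the tree:

* `exists_weilType_abelianSurfaces_algebraic` (`WeilClassesSurfacesAlgebraic`): for every `d ≥ 1` a Weil-type
  SURFACE `(B, ψ)`, `ψ ≫ ψ = -d`, with a non-zero rational `(1,1)` Weil class (the companion square `E × E`);
* `exists_weilTypeSurface_prod_isHyperbolicWeilType_all_holds` (`WeilClassesDescendingHolds`; Markman arXiv:2509.23403
  §11.5 Step 2 / van Geemen 5.5 / Schoen 1998 §7, every dimension, PROVED): a `2n`-fold with a non-zero rational
  `(n,n)` Weil class times a suitable Weil SURFACE is HYPERBOLIC of dimension `2(n+1)` for a `K`-symmetrised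
  hyperplane class;
* `finrank_eigenspace_inf_hodgeOneZero_eq_of_isHyperbolicWeilType` (`HyperbolicWeilTypeBalanced`: hyperbolic ⟹
  balanced type `(n,n)`), `exists_isRationalClass_ne_zero_mem_weilClassesOf` (`WeilClassesRationalPlane`: the Weil
  plane has a non-zero RATIONAL class, van Geemen 4.9) and `isOfHodgeType_of_mem_weilClassesOf`
  (`WeilClassesHodgeType`: on balanced type every Weil class is `(n,n)`, Deligne–Milne Prop. 4.4).

Results (induction on `n`, products `((E × E) × S₂) × S₃ × ⋯`):
* `exists_weilType_rational_hodge_weilClass` — for every `n ≥ 1`, `d ≥ 1` an abelian `2n`-fold `(A, φ)`,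
  `φ ≫ φ = -d`, with a non-zero rational `(n,n)` class in `weilClassesOf A φ n d` (Weil type `(n,n)` is inhabited);
* `exists_isHyperbolicWeilType` — for every `n ≥ 2`, `d ≥ 1` a HYPERBOLIC `(P, ψ₀)` of dimension `2n` for the
  `K`-symmetrised hyperplane class `d·e^*a + ψ₀^*e^*a` of some projective embedding `e` and rational `a ≠ 0`;
* `exists_isHyperbolicWeilType_with_weilClass` — the same together with a non-zero RATIONAL `(n,n)` class of its
  Weil plane (the anchor data of `HasLocallyAlgebraicWeilAnchor n d`).

Not here: `n = 1` hyperbolic SURFACES (split Weil surfaces exist, e.g. `E × E`, but the partner theorem starts one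
dimension up; not needed by the ladder, whose rungs have `n ≥ 2`), and any statement about which COMPONENT
(discriminant) the non-hyperbolic examples lie in.

## References
* [Markman2025SurveySecant] E. Markman, arXiv:2509.23403, §11.5 Steps 1–2 (partner surfaces; split = `(-1)ⁿ`).
* [vanGeemen1994HodgeAV] B. van Geemen, LNM 1594 (1994), 4.9, Lemma 5.2, 5.4–5.5.
* [Schoen1998HodgeWeilAddendum] C. Schoen, Compositio Math. 114 (1998), §7, §10.
* [Deligne1982HodgeCycles] P. Deligne, LNM 900 (1982), Prop. 4.4, proof of Thm. 4.8.
-/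

noncomputable section

open CategoryTheory

namespace Literature.AlgebraicGeometry.HodgeTheory

open Literature.AlgebraicTopology.SingularHomology
open Literature.AlgebraicGeometry.Motives (isSmoothProjective_of_dim_eq')

section HodgeTheory

/-- **A hyperbolic `(A, φ)` carries a non-zero RATIONAL `(n,n)` Weil class**: the Weil plane has a non-zero
rational class (van Geemen 4.9), and hyperbolic ⟹ balanced type `(n,n)` ⟹ every Weil class is of type `(n,n)`
(Deligne–Milne Prop. 4.4). [cite: vanGeemen1994HodgeAV, 4.9 and Lemma 5.2 (1)] [cite: Deligne1982HodgeCycles, Prop. 4.4] -/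
theorem exists_rational_hodge_weilClass_of_isHyperbolicWeilType {n d : ℕ} (hn : 0 < n) (hd : 0 < d)
    {A : Motives.AbelianVariety ℂ} {φ : A ⟶ A} (hA : A.dim = 2 * n) (hφ : φ ≫ φ = -(d • 𝟙 A))
    (e : Motives.ProjectiveEmbedding A.X) {a : complexBetti (Motives.projectiveSpace e.n ℂ) 2}
    (ha : IsRationalClass a) (ha0 : a ≠ 0)
    (hhyp : Motives.IsHyperbolicWeilType A φ n
      ((d : ℂ) • complexBetti.map e.ι 2 a + complexBetti.map φ.hom.hom.hom 2 (complexBetti.map e.ι 2 a))) :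
    ∃ c : complexBetti A.X (2 * n), IsRationalClass c ∧ IsOfHodgeType (2 * n) A.X (2 * n) n n c ∧
      c ∈ weilClassesOf A φ n d ∧ c ≠ 0 := by
  obtain ⟨c, hcW, hc0, hcr⟩ := exists_isRationalClass_ne_zero_mem_weilClassesOf hn hA hd hφ
  exact ⟨c, hcr, isOfHodgeType_of_mem_weilClassesOf hn hA hd hφ
    (finrank_eigenspace_inf_hodgeOneZero_eq_of_isHyperbolicWeilType hn hd hA hφ e ha ha0 hhyp) hcW, hcW, hc0⟩

/-- **One dimension up**: an abelian `2n`-fold `(A₁, φ₁)`, `φ₁ ≫ φ₁ = -d`, with a non-zero rational `(n,n)` Weil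
class gives a HYPERBOLIC `(A₁ × A₂, φ₁ × φ₂)` of dimension `2(n+1)` for a `K`-symmetrised hyperplane class (partner
Weil surface of complementary discriminant — the tree's PROVED `exists_weilTypeSurface_prod_isHyperbolicWeilType_all`).
[cite: Markman2025SurveySecant, §11.5 Step 2] [cite: vanGeemen1994HodgeAV, 5.5] -/
theorem exists_isHyperbolicWeilType_succ_of_weilClass {n d : ℕ} (hn : 0 < n) (hd : 0 < d)
    {A₁ : Motives.AbelianVariety ℂ} {φ₁ : A₁ ⟶ A₁} (hA₁ : A₁.dim = 2 * n) (hφ₁ : φ₁ ≫ φ₁ = -(d • 𝟙 A₁))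
    (hc : ∃ c : complexBetti A₁.X (2 * n), IsRationalClass c ∧
      IsOfHodgeType (2 * n) A₁.X (2 * n) n n c ∧ c ∈ weilClassesOf A₁ φ₁ n d ∧ c ≠ 0) :
    ∃ (P : Motives.AbelianVariety ℂ) (ψ₀ : P ⟶ P) (e : Motives.ProjectiveEmbedding P.X)
      (a : complexBetti (Motives.projectiveSpace e.n ℂ) 2),
      P.dim = 2 * (n + 1) ∧ ψ₀ ≫ ψ₀ = -(d • 𝟙 P) ∧ IsRationalClass a ∧ a ≠ 0 ∧
      Motives.IsHyperbolicWeilType P ψ₀ (n + 1)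
        ((d : ℂ) • complexBetti.map e.ι 2 a + complexBetti.map ψ₀.hom.hom.hom 2 (complexBetti.map e.ι 2 a)) := by
  obtain ⟨A₂, φ₂, hA₂, -, hφ₂, -, e, a, ha, ha0, hhyp⟩ :=
    exists_weilTypeSurface_prod_isHyperbolicWeilType_all_holds n hn d hd A₁ φ₁ hA₁
      (isSmoothProjective_of_dim_eq' hA₁) hφ₁ hc
  exact ⟨A₁.prod A₂, _, e, a, dim_prod_eq_two_mul hA₁ hA₂, prodLift_comp_self_eq_neg_nsmul hφ₁ hφ₂, ha, ha0, hhyp⟩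

/-- **Hyperbolic Weil-type abelian `2n`-folds exist for every `n ≥ 2` and every `d ≥ 1`** (with the
`K`-symmetrised hyperplane class of a projective embedding, the typing of the ladder's split rungs and of
`weilFamilyReach_hyperbolic`): induction from the Weil-type surface `E × E` (`exists_weilType_abelianSurfaces_algebraic`)
by partner surfaces. [cite: Markman2025SurveySecant, §11.5 Step 2] [cite: vanGeemen1994HodgeAV, 5.4–5.5] -/
theorem exists_isHyperbolicWeilType (n d : ℕ) (hn : 2 ≤ n) (hd : 0 < d) :
    ∃ (P : Motives.AbelianVariety ℂ) (ψ₀ : P ⟶ P) (e : Motives.ProjectiveEmbedding P.X)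
      (a : complexBetti (Motives.projectiveSpace e.n ℂ) 2),
      P.dim = 2 * n ∧ ψ₀ ≫ ψ₀ = -(d • 𝟙 P) ∧ IsRationalClass a ∧ a ≠ 0 ∧
      Motives.IsHyperbolicWeilType P ψ₀ n
        ((d : ℂ) • complexBetti.map e.ι 2 a + complexBetti.map ψ₀.hom.hom.hom 2 (complexBetti.map e.ι 2 a)) := by
  -- induction on `n ≥ 2`, written as `n = m + 2`
  obtain ⟨m, rfl⟩ : ∃ m, n = m + 2 := ⟨n - 2, by omega⟩
  clear hn
  induction m with
  | zero =>
    -- the Weil-type surface `E × E` and its partner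
    obtain ⟨B, ψ, b, hB, hψ, hbr, hbH, hbW, -, hbb⟩ := exists_weilType_abelianSurfaces_algebraic d hd
    have hb0 : b ≠ 0 := by
      intro h
      apply hbb
      rw [h, LinearMap.map_zero₂]
    exact exists_isHyperbolicWeilType_succ_of_weilClass one_pos hd (n := 1) (by simpa using hB) hψ
      ⟨b, hbr, hbH, hbW, hb0⟩
  | succ m ih =>
    obtain ⟨P, ψ₀, e, a, hP, hψ₀, ha, ha0, hhyp⟩ := ih
    exact exists_isHyperbolicWeilType_succ_of_weilClass (n := m + 2) (by omega) hd hP hψ₀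
      (exists_rational_hodge_weilClass_of_isHyperbolicWeilType (by omega) hd hP hψ₀ e ha ha0 hhyp)

/-- **Weil type `(n,n)` is inhabited, with a non-zero RATIONAL `(n,n)` Weil class, for every `n ≥ 1`, `d ≥ 1`**
(`n = 1`: the surface `E × E`; `n ≥ 2`: the hyperbolic examples). [cite: vanGeemen1994HodgeAV, 4.9 and 5.5] -/
theorem exists_weilType_rational_hodge_weilClass (n d : ℕ) (hn : 0 < n) (hd : 0 < d) :
    ∃ (A : Motives.AbelianVariety ℂ) (φ : A ⟶ A) (c : complexBetti A.X (2 * n)),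
      A.dim = 2 * n ∧ φ ≫ φ = -(d • 𝟙 A) ∧ IsRationalClass c ∧ IsOfHodgeType (2 * n) A.X (2 * n) n n c ∧
      c ∈ weilClassesOf A φ n d ∧ c ≠ 0 := by
  rcases Nat.lt_or_ge n 2 with h1 | h2
  · obtain rfl : n = 1 := by omega
    obtain ⟨B, ψ, b, hB, hψ, hbr, hbH, hbW, -, hbb⟩ := exists_weilType_abelianSurfaces_algebraic d hd
    have hb0 : b ≠ 0 := by
      intro h
      apply hbb
      rw [h, LinearMap.map_zero₂]
    exact ⟨B, ψ, b, by simpa using hB, hψ, hbr, hbH, hbW, hb0⟩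
  · obtain ⟨P, ψ₀, e, a, hP, hψ₀, ha, ha0, hhyp⟩ := exists_isHyperbolicWeilType n d h2 hd
    obtain ⟨c, hcr, hcH, hcW, hc0⟩ :=
      exists_rational_hodge_weilClass_of_isHyperbolicWeilType (by omega) hd hP hψ₀ e ha ha0 hhyp
    exact ⟨P, ψ₀, c, hP, hψ₀, hcr, hcH, hcW, hc0⟩

/-- **Hyperbolic anchor data exist**: for `n ≥ 2`, `d ≥ 1` a hyperbolic `(P, ψ₀, e, a)` of dimension `2n`,
`ψ₀ ≫ ψ₀ = -d`, together with a non-zero RATIONAL `(n,n)` class of its Weil plane — the data of the predicate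
`HasLocallyAlgebraicWeilAnchor n d` up to its local clause (which holds under the Hodge conjecture).
[cite: vanGeemen1994HodgeAV, 4.9, Lemma 5.2 and 5.5] [cite: Deligne1982HodgeCycles, Prop. 4.4] -/
theorem exists_isHyperbolicWeilType_with_weilClass (n d : ℕ) (hn : 2 ≤ n) (hd : 0 < d) :
    ∃ (P : Motives.AbelianVariety ℂ) (ψ₀ : P ⟶ P) (e : Motives.ProjectiveEmbedding P.X)
      (a : complexBetti (Motives.projectiveSpace e.n ℂ) 2) (w : complexBetti P.X (2 * n)),
      P.dim = 2 * n ∧ ψ₀ ≫ ψ₀ = -(d • 𝟙 P) ∧ IsRationalClass a ∧ a ≠ 0 ∧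
      Motives.IsHyperbolicWeilType P ψ₀ n
        ((d : ℂ) • complexBetti.map e.ι 2 a + complexBetti.map ψ₀.hom.hom.hom 2 (complexBetti.map e.ι 2 a)) ∧
      w ∈ weilClassesOf P ψ₀ n d ∧ IsRationalClass w ∧ w ≠ 0 ∧ IsOfHodgeType (2 * n) P.X (2 * n) n n w := by
  obtain ⟨P, ψ₀, e, a, hP, hψ₀, ha, ha0, hhyp⟩ := exists_isHyperbolicWeilType n d hn hd
  obtain ⟨c, hcr, hcH, hcW, hc0⟩ :=
    exists_rational_hodge_weilClass_of_isHyperbolicWeilType (by omega) hd hP hψ₀ e ha ha0 hhyp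
  exact ⟨P, ψ₀, e, a, c, hP, hψ₀, ha, ha0, hhyp, hcW, hcr, hc0, hcH⟩

end HodgeTheory

end Literature.AlgebraicGeometry.HodgeTheory

end
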